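import Mathlib
import HarnessLib
import Literature.Analysis.PDE.DivFormLiouville
import Literature.Analysis.FunctionSpaces.MoserIteration
import Summits.NavierStokesRegularity.NavierStokesRegularity.Theorems.PoloidalWindowDoorPoloidalWindowRigidityDivFormMoserStep

/-!
# Route `PoloidalWindowDoor`, crux K2 (stmt-NavierStokesRegularity-19708) — task H5, step M3c: the MOSER ITERATION for
# positive and negative powers of an entire solution of `div(a∇u) = 0`, `n ≥ 3` (towards `divFormLiouville_holds`)

Seat ns-poloidal-K2-p3 g2 (`ledger fact claim` #1 on `Literature.Analysis.PDE.divFormLiouville`; setting = that fact's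
rendering, `w ≥ 1` an entire `C¹` weak solution).  Moser 1961 §4 / Gilbarg–Trudinger Thm 8.18: the reverse Hölder step
M3b (`…DivFormMoserStep.moser_step`) is chained along the radii `r_k = R(1 + 2^{-k})` (from `2R` down to `R`) and the
exponents `p_k = p₀ κ^k`, `κ = n/(n−2)`, with the tree's `Literature.Analysis.FunctionSpaces.eLpNorm_top_le_of_moser_chain`:
for `f = w^σ`, `σ = ±1`, provided no chain exponent `σ p_k` equals `1` and `(σp_k/(σp_k − 1))² ≤ D` along the chain,
`‖f‖_{L^∞(B̄(x₀,R))} ≤ (K/R²)^{κ/(p₀(κ−1))} · 4^{κ/(p₀(κ−1)²)} · ‖f‖_{L^{p₀}(B̄(x₀,2R))}`,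
`K = max(C_S,1)² · 8 (DnΛ + λ) C₀²/λ` — `κ/(κ−1) = n/2`, so the right side is scale-invariant:
`(K/R²)^{n/(2p₀)} ‖f‖_{L^{p₀}(B̄_{2R})} = K^{n/(2p₀)} (R^{-n} ∫_{B̄_{2R}} f^{p₀})^{1/p₀}`.

* `moser_chain_sup` — the displayed local boundedness of `w^σ` (both signs).

WHAT THIS IS NOT: not yet the Liouville theorem (M4: Harnack ⇒ Liouville, and `n ≤ 2`); nothing NS-specific.
-/

noncomputable section

open MeasureTheory Set Function Filter Topology Metric Module
open scoped Matrix ENNReal NNReal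

-- the summit and its single sub-problem share the name (CONVENTIONS §1), as in every Theorems file
set_option linter.dupNamespace false

namespace Summit.NavierStokesRegularity.NavierStokesRegularity.Theorems.PoloidalWindowDoorPoloidalWindowRigidityDivFormMoserChain

open Summit.NavierStokesRegularity.NavierStokesRegularity.Theorems.PoloidalWindowDoorPoloidalWindowRigidityDivFormReverseHolder
open Summit.NavierStokesRegularity.NavierStokesRegularity.Theorems.PoloidalWindowDoorPoloidalWindowRigidityDivFormMoserStep
open Literature.Analysis.FunctionSpaces

variable {n : ℕ} {a : EuclideanSpace ℝ (Fin n) → Matrix (Fin n) (Fin n) ℝ} {lam Λ : ℝ}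
  {w : EuclideanSpace ℝ (Fin n) → ℝ}

/-- **MOSER ITERATION, local boundedness of `w^σ`** (Moser 1961 §4; Gilbarg–Trudinger Thm 8.18, proof), `n ≥ 3`,
`κ = n/(n−2)`: for an entire `C¹` weak solution `w ≥ 1`, `σ = ±1`, `p₀ > 0` such that along the chain `p_k = p₀κ^k`
no `σp_k` equals `1` and `(σp_k/(σp_k−1))² ≤ D`, every `x₀` and `R > 0`:
`‖w^σ‖_{L^∞(B̄(x₀,R))} ≤ (K/R²)^{κ/(p₀(κ−1))} 4^{κ/(p₀(κ−1)²)} ‖w^σ‖_{L^{p₀}(B̄(x₀,2R))}`,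
`K = max(C_S,1)² · 2(DnΛ + λ)/λ · 4C₀²` (`C_S` Mathlib's Sobolev constant, `C₀` the cutoff constant). -/
theorem moser_chain_sup (hn : 3 ≤ n) (hsymm : ∀ y, (a y).IsSymm) (hlam : 0 < lam)
    (hmeas : ∀ i j, Measurable fun y => a y i j)
    (hell : ∀ y (ξ : Fin n → ℝ), lam * (ξ ⬝ᵥ ξ) ≤ ξ ⬝ᵥ (a y *ᵥ ξ)) (hbd : ∀ y i j, |a y i j| ≤ Λ)
    (hw : ContDiff ℝ 1 w) (hw1 : ∀ y, 1 ≤ w y)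
    (hweak : ∀ η : EuclideanSpace ℝ (Fin n) → ℝ, ContDiff ℝ 1 η → HasCompactSupport η →
      ∫ y, ∑ i, ∑ j, a y i j * fderiv ℝ w y (EuclideanSpace.single i 1) *
        fderiv ℝ η y (EuclideanSpace.single j 1) = 0)
    {σ : ℝ} (hσ : σ = 1 ∨ σ = -1) {p₀ : ℝ} (hp₀ : 0 < p₀) {D : ℝ} (hD0 : 0 ≤ D)
    (hne : ∀ k : ℕ, σ * (p₀ * (n / (n - 2 : ℝ)) ^ k) ≠ 1)
    (hD : ∀ k : ℕ, (σ * (p₀ * (n / (n - 2 : ℝ)) ^ k) / (σ * (p₀ * (n / (n - 2 : ℝ)) ^ k) - 1)) ^ 2 ≤ D)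
    {C₀ : ℝ} (hC₀ : 0 < C₀) (hcut : ∀ (x₀ : EuclideanSpace ℝ (Fin n)) (ρ' ρ : ℝ), 0 < ρ' → ρ' < ρ →
      ∃ χ : EuclideanSpace ℝ (Fin n) → ℝ, ContDiff ℝ 1 χ ∧ HasCompactSupport χ ∧ (∀ x, 0 ≤ χ x ∧ χ x ≤ 1) ∧
        (∀ x ∈ closedBall x₀ ρ', χ x = 1) ∧ (∀ x, x ∉ ball x₀ ρ → χ x = 0) ∧ ∀ x, ‖fderiv ℝ χ x‖ ≤ C₀ / (ρ - ρ'))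
    (x₀ : EuclideanSpace ℝ (Fin n)) {R : ℝ} (hR : 0 < R) :
    eLpNorm (fun y => w y ^ σ) ∞ (volume.restrict (closedBall x₀ R)) ≤
      ENNReal.ofReal ((max (eLpNormLESNormFDerivOfEqInnerConst (volume : Measure (EuclideanSpace ℝ (Fin n))) 2 : ℝ) 1) ^ 2
            * (2 * (D * (n * Λ) + lam) / lam * (4 * C₀ ^ 2)) / R ^ 2) ^
          ((n / (n - 2 : ℝ)) / (p₀ * ((n / (n - 2 : ℝ)) - 1))) *
        (4 : ℝ≥0∞) ^ ((n / (n - 2 : ℝ)) / (p₀ * ((n / (n - 2 : ℝ)) - 1) ^ 2)) *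
        eLpNorm (fun y => w y ^ σ) (ENNReal.ofReal p₀) (volume.restrict (closedBall x₀ (2 * R))) := by
  -- notation
  set κ : ℝ := n / (n - 2 : ℝ) with hκ
  set CS : ℝ≥0 := eLpNormLESNormFDerivOfEqInnerConst (volume : Measure (EuclideanSpace ℝ (Fin n))) 2 with hCS
  set K : ℝ := (max (CS : ℝ) 1) ^ 2 * (2 * (D * (n * Λ) + lam) / lam * (4 * C₀ ^ 2)) with hK
  have hn2 : (0 : ℝ) < n - 2 := by
    have : (3 : ℝ) ≤ n := by exact_mod_cast hn
    linarith
  have hκ1 : 1 < κ := by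
    rw [hκ, lt_div_iff₀ hn2]; linarith
  have hκ0 : 0 < κ := zero_lt_one.trans hκ1
  have hpos : ∀ y, 0 < w y := fun y => lt_of_lt_of_le one_pos (hw1 y)
  have hnΛ : 0 ≤ (n : ℝ) * Λ :=
    mul_nonneg (Nat.cast_nonneg n) ((abs_nonneg _).trans (hbd x₀ ⟨0, by omega⟩ ⟨0, by omega⟩))
  have hmax : (1 : ℝ) ≤ max (CS : ℝ) 1 := le_max_right _ _
  have hKpos : 0 < K := by rw [hK]; positivity
  -- radii and sets
  set r : ℕ → ℝ := fun k => R * (1 + (2 : ℝ)⁻¹ ^ k) with hr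
  set A : ℕ → Set (EuclideanSpace ℝ (Fin n)) := fun k => closedBall x₀ (r k) with hA
  have hrpos : ∀ k, 0 < r k := fun k => by positivity
  have hrdiff : ∀ k, r k - r (k + 1) = R * (2 : ℝ)⁻¹ ^ (k + 1) := fun k => by
    simp only [hr, pow_succ]; ring
  have hrlt : ∀ k, r (k + 1) < r k := fun k => by
    have h := hrdiff k
    have : (0 : ℝ) < R * (2 : ℝ)⁻¹ ^ (k + 1) := by positivity
    linarith
  -- the chain constants
  set Cch : ℝ≥0 := Real.toNNReal (K / R ^ 2) with hCch
  have hCch0 : Cch ≠ 0 := by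
    rw [hCch]; exact (Real.toNNReal_pos.2 (by positivity)).ne'
  have hb : (4 : ℝ≥0) ≠ 0 := by norm_num
  have hcoeC : ((Cch : ℝ≥0) : ℝ≥0∞) = ENNReal.ofReal (K / R ^ 2) := rfl
  have hcoe4 : ((4 : ℝ≥0) : ℝ≥0∞) = 4 := by norm_num
  -- the reverse Hölder chain
  have H : ∀ k : ℕ, eLpNorm (fun y => w y ^ σ) (ENNReal.ofReal (p₀ * κ ^ (k + 1))) (volume.restrict (A (k + 1))) ≤
      (((Cch : ℝ≥0) : ℝ≥0∞) * ((4 : ℝ≥0) : ℝ≥0∞) ^ k) ^ (1 / (p₀ * κ ^ k)) *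
        eLpNorm (fun y => w y ^ σ) (ENNReal.ofReal (p₀ * κ ^ k)) (volume.restrict (A k)) := by
    intro k
    have hpk : 0 < p₀ * κ ^ k := by positivity
    have hstep := moser_step hn hsymm hlam hmeas hell hbd hw hw1 hweak hσ hpk (hne k) hcut x₀ (hrpos (k + 1)) (hrlt k)
    rw [pow_succ, ← mul_assoc]
    refine hstep.trans (mul_le_mul' (ENNReal.rpow_le_rpow ?_ (by positivity)) le_rfl)
    -- the step constant is at most `Cch · 4^k`
    rw [hcoeC, hcoe4, show (4 : ℝ≥0∞) ^ k = ENNReal.ofReal (4 ^ k) by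
      rw [ENNReal.ofReal_pow (by norm_num : (0:ℝ) ≤ 4)]; norm_num, ← ENNReal.ofReal_mul (by positivity)]
    refine ENNReal.ofReal_le_ofReal ?_
    set q : ℝ := σ * (p₀ * κ ^ k) with hq
    have h1 : (q / (q - 1)) ^ 2 * (n * Λ) ≤ D * (n * Λ) := mul_le_mul_of_nonneg_right (hD k) hnΛ
    have h2 : (C₀ / (r k - r (k + 1))) ^ 2 = 4 * C₀ ^ 2 * 4 ^ k / R ^ 2 := by
      rw [hrdiff, inv_pow, show (4 : ℝ) ^ k = (2 ^ k) ^ 2 by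
        rw [show (4 : ℝ) = 2 ^ 2 by norm_num, ← pow_mul, ← pow_mul, mul_comm]]
      field_simp
      ring
    have h3 : (CS : ℝ) ^ 2 ≤ (max (CS : ℝ) 1) ^ 2 := pow_le_pow_left₀ (NNReal.coe_nonneg _) (le_max_left _ _) 2
    have h4 : 2 * ((q / (q - 1)) ^ 2 * (n * Λ) + lam) / lam ≤ 2 * (D * (n * Λ) + lam) / lam := by
      refine div_le_div_of_nonneg_right ?_ hlam.le
      linarith
    have h4' : 0 ≤ 2 * ((q / (q - 1)) ^ 2 * (n * Λ) + lam) / lam := by positivity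
    calc (CS : ℝ) ^ 2 * (2 * ((q / (q - 1)) ^ 2 * (n * Λ) + lam) / lam * (C₀ / (r k - r (k + 1))) ^ 2)
        = (CS : ℝ) ^ 2 * (2 * ((q / (q - 1)) ^ 2 * (n * Λ) + lam) / lam) * (4 * C₀ ^ 2 * 4 ^ k / R ^ 2) := by
          rw [h2]; ring
      _ ≤ (max (CS : ℝ) 1) ^ 2 * (2 * (D * (n * Λ) + lam) / lam) * (4 * C₀ ^ 2 * 4 ^ k / R ^ 2) := by
          have h5 : 0 ≤ 4 * C₀ ^ 2 * 4 ^ k / R ^ 2 := by positivity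
          exact mul_le_mul_of_nonneg_right (mul_le_mul h3 h4 h4' (by positivity)) h5
      _ = K / R ^ 2 * 4 ^ k := by rw [hK]; ring
  -- Moser's iteration lemma
  have hf : AEStronglyMeasurable (fun y => w y ^ σ) (volume : Measure (EuclideanSpace ℝ (Fin n))) :=
    (contDiff_rpow_of_one_le hw hw1 σ).continuous.aestronglyMeasurable
  have hchain := eLpNorm_top_le_of_moser_chain (μ := (volume : Measure (EuclideanSpace ℝ (Fin n)))) hf
    (A := A) hp₀ hκ1 hCch0 hb H
  -- `B̄(x₀,R) ⊆ ⋂ A_k` and `A 0 = B̄(x₀,2R)`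
  have hsub : closedBall x₀ R ⊆ ⋂ k, A k := by
    refine subset_iInter fun k => closedBall_subset_closedBall ?_
    have : (0 : ℝ) ≤ R * (2 : ℝ)⁻¹ ^ k := by positivity
    simp only [hr]; linarith
  have hA0 : A 0 = closedBall x₀ (2 * R) := by
    simp only [hA, hr, pow_zero]; ring_nf
  calc eLpNorm (fun y => w y ^ σ) ∞ (volume.restrict (closedBall x₀ R))
      ≤ eLpNorm (fun y => w y ^ σ) ∞ (volume.restrict (⋂ k, A k)) :=
        eLpNorm_mono_measure _ (Measure.restrict_mono hsub le_rfl)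
    _ ≤ ((Cch : ℝ≥0) : ℝ≥0∞) ^ (κ / (p₀ * (κ - 1))) * ((4 : ℝ≥0) : ℝ≥0∞) ^ (κ / (p₀ * (κ - 1) ^ 2)) *
          eLpNorm (fun y => w y ^ σ) (ENNReal.ofReal p₀) (volume.restrict (A 0)) := hchain
    _ = ENNReal.ofReal (K / R ^ 2) ^ (κ / (p₀ * (κ - 1))) * (4 : ℝ≥0∞) ^ (κ / (p₀ * (κ - 1) ^ 2)) *
          eLpNorm (fun y => w y ^ σ) (ENNReal.ofReal p₀) (volume.restrict (closedBall x₀ (2 * R))) := by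
        rw [hcoeC, hcoe4, hA0]

end Summit.NavierStokesRegularity.NavierStokesRegularity.Theorems.PoloidalWindowDoorPoloidalWindowRigidityDivFormMoserChain

end
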